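import Mathlib.LinearAlgebra.RootSystem.Base
import Mathlib.GroupTheory.Solvable
import Mathlib.LinearAlgebra.Dual.Lemmas
import Literature.NumberTheory.Automorphic.DiagonalizableGroups
import Literature.NumberTheory.Automorphic.RootData
import HarnessLib

/-!
# Solvability of `⟨T, U_α : α > 0⟩` by the weight filtration of `kⁿ`
(trunk T-AUTOMORPHIC, G25 AutomorphicL; Springer, *Linear Algebraic Groups*, 8.2.4 (i), solvability)

Companion to `LinearAlgebraicGroups.lean`, `RootData.lean` and `DiagonalizableGroups.lean`
(namespace `Literature.Automorphic`, concrete `k`-points vocabulary: subgroups `G, T ≤ GL n k`, algebraic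
characters `characterLattice T = X*(T)`, root homomorphisms `IsRootHom`, root subgroups
`rootSubgroup G T α = U_α`, weight spaces `weightSpace T w ⊆ kⁿ`). Springer 8.2.4 (i) says
that for a connected reductive `G` with maximal torus `T` and a system of positive roots `R⁺`,
*`T` and the `U_α` (`α ∈ R⁺`) generate a Borel subgroup*; the printed proof gets the
solvability of `T · U⁺` from the commutator relations 8.2.3. This file proves the solvability
clause directly and in greater generality (`isSolvable_sup_iSup_rootSubgroup_of_isPos`): for
**any** torus `T ≤ G ≤ GL n k` over an algebraically closed field, any root pairing `P` over `ℤ`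
with a base `b` (Mathlib `RootPairing.Base`) and any identification `eX : X*(T) ≃ X`, the
subgroup `T ⊔ ⨆_{b.IsPos i} U_{α_i}` of `GL n k` (`α_i` the character of weight `P.root i`) is
solvable. Consumer: `ReductiveDualChevalleyBasedProofs.lean` (the based form of Chevalley's
existence theorem, lang.S13 (c)), where it discharges the named fact `isSolvable_borelOfBase`
and, with `exists_isBorelIn_ge` (`ZariskiGL.lean`), yields a Borel subgroup above
`⟨T, U_α : α > 0⟩` without 8.2.3, 8.1.3 (ii) or 6.2.7 (iii). The unconditional theorem
`isSolvable_sup_iSup_rootSubgroup_of_isPos` supersedes the conditional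
`isSolvable_sup_iSup_rootSubgroup_of` of `RootSubgroupCommutators.lean` (same conclusion, granted
`rootSubgroup_unique`, `rootSubgroup_commutator_le`, `IsConnectedReductive`, `IsMaximalTorusIn` and
`IsRootDatumOf`), which can be retired once no consumer uses it; only commutativity of `T` and
semisimplicity of its elements are used (`isSolvable_sup_iSup_rootSubgroup_of_isSemisimple`), the
torus form being a corollary. Also proved here, for the module theory of constructed groups:
`coeffMatrix_mulVec_mem_of_forall_mem` (a subspace stable under an algebraic one-parameter group
is stable under all its coefficient matrices, in particular under its tangent `A₁`).

## The argument (Springer 3.2.15–3.2.16 (4), 8.4.5, 2.1.5 (4), made elementary)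

For a cocharacter `λ` the group `P(λ) = {x | lim_{a → 0} λ(a) x λ(a)⁻¹ exists}` is, inside
`GL(V)`, the stabiliser of a flag (3.2.16 (4)), and `U_α ⊆ P(λ)` when `⟨α, λ⟩ > 0` (8.4.5,
proof). We replace the cocharacter by a combinatorial rank on the weights of `T` and the flag
stabiliser by an explicit filtered algebra, so that no structure theory is needed:

* **Level algebra** (section `LevelAlgebra`, for arbitrary pieces `W : C → Submodule k kⁿ` and
  ranks `r : C → ℕ`): `stepFiltration W r m c = ⨆_{r c' ≥ r c + m} W c'`; the *raising*
  matrices `n_m = raising W r m` (`x (W c) ⊆ stepFiltration m c`), with `n_a n_b ⊆ n_{a+b}`;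
  the *block scalar* matrices `D = blockScalar W` (a scalar on each piece); the *level algebra*
  `A = D + n₁` (`levelAlg`), closed under products with `[A, A] ⊆ n₁` and `A n_m, n_m A ⊆ n_m`;
  the *level group* `Q = {g ∈ GL n k | g, g⁻¹ ∈ A}` (`levelGroup`) and the *raising groups*
  `U_m = GL n k ∩ (1 + n_m)` (`raisingGroup`). Then `(Q, Q) ⊆ U₁`, `(U_a, U_b) ⊆ U_{a+b}`, so the
  derived series of `Q` descends the `U_m` (`map_derivedSeries_succ_le`); if all ranks are `< B`
  and `⨆ W c = ⊤` then `n_B = 0`, `U_B = 1` and **`Q` is solvable** (`isSolvable_levelGroup`;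
  this is the solvability of the triangular group, Springer 2.1.5 (4), in invariant form).
* **Weights** (section `TorusWeights`): for `T` commutative, the weight spaces `V_χ`
  (`charWeightSpace T χ`, `χ ∈ X*(T)`) are independent (Mathlib, simultaneous generalised
  eigenspaces of commuting families), so the *weights* `Weights T = {χ | V_χ ≠ 0}` form a finite
  type (`iSupIndep.fintypeNeBotOfFiniteDimensional`); if moreover `T` consists of semisimple
  elements and `k` is algebraically closed, `⨆_χ V_χ = kⁿ` (Springer 2.4.2 (ii),
  `iSup_weightSpace_eq_top` of `DiagonalizableGroups.lean` plus `isAlgebraicChar_weightChar`);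
  `T` is block scalar, hence `T ≤ Q` for every rank function (`le_levelGroup_weights`).
* **Coefficients of root homomorphisms** (section `AddHomCoeff`): an algebraic `u : 𝔾ₐ → G` is
  `u(x) = ∑ⱼ xʲ Aⱼ` with `A₀ = 1` (`coeffMatrix`, `coe_eq_sum_coeffMatrix`); if
  `t u(x) t⁻¹ = u(α(t) x)` then `t Aⱼ t⁻¹ = α(t)ʲ Aⱼ` (`conj_coeffMatrix`, comparison of
  coefficients over an infinite field, as in `IsRootHom.exists_weightVector` of
  `RootDataRootsFiniteProofs.lean` for `j = 1`), whence `Aⱼ V_χ ⊆ V_{χ αʲ}`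
  (`coeffMatrix_mulVec_mem`). So if `α` raises the rank, `u(x) ∈ U₁ ≤ Q` and `U_α ≤ Q`
  (`rootSubgroup_le_levelGroup`).
* **Ranks from a base** (sections `Rank`, `BaseHeight`): the height functional
  `baseHeightHom P b : ℤR → ℤ` (sum of coordinates in Mathlib's `b.toWeightBasisInt`; it is
  `b.height` on roots, `baseHeightHom_rootSpanMem`) defines the strict partial order
  `PosStep P b x x'` (`x' - x ∈ ℤR` of positive height) on `X`, and `rankOf` (number of weights
  below) is strictly monotone along it; adding a `b`-positive root is a positive step.
* **Assembly** (`isSolvable_sup_iSup_rootSubgroup_of_isPos`): with these ranks every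
  `b`-positive root raises the rank, so `T ⊔ ⨆_{α > 0} U_α ≤ Q` is solvable.

## Mathlib

Used: `Module.End.independent_iInf_maxGenEigenspace_of_forall_mapsTo`,
`Module.End.mapsTo_maxGenEigenspace_of_comm`, `Module.End.eigenspace_le_maxGenEigenspace`,
`iSupIndep.fintypeNeBotOfFiniteDimensional`, `derivedSeries`, `Subgroup.map_commutator`,
`Subgroup.commutator_le`, `solvable_of_solvable_injective`, `Polynomial.funext`,
`Polynomial.comp_C_mul_X_coeff`, `Polynomial.eval_eq_sum_range'`, `RootPairing.Base.height`,
`RootPairing.Base.toWeightBasisInt`, `RootPairing.Base.exists_root_eq_sum_int`. Mathlib has no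
solvability statement for triangular or flag-stabilising matrix groups (`lean search` for
`IsSolvable` near `triangular` / `unitriangular`: no Mathlib hits; group-theoretic `IsSolvable`
results concern abstract extensions and Galois groups) and no algebraic groups. In the tree, the
upper triangular `borelSubgroup σ k` (`DiophantineGeometry/GLHighestWeight.lean`) and the
unitriangular subgroup of `ParabolicGL.lean` come without solvability statements; the level
group of a full flag with one-dimensional pieces is such a triangular group, but the invariant
form (pieces of any dimension, partial order of ranks) is what the weight decomposition gives.
Nothing here duplicates a Mathlib declaration.

## References

* [SpringerLAG1998] T. A. Springer, *Linear Algebraic Groups*, 2nd ed., Progress in Mathematics 9,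
  Birkhäuser (1998): 2.1.5 (4), 2.4.2 (ii), 3.2.15, 3.2.16 (4), 8.1.1 (i), 8.2.4 (i), 8.4.5.
-/

noncomputable section

open scoped MatrixGroups IsMulCommutative

namespace Literature.NumberTheory.Automorphic

variable {k : Type*} [Field k] {n : Type*}

/-! ### The level algebra of a graded decomposition and its solvable unit group -/

section LevelAlgebra

variable {C : Type*} (W : C → Submodule k (n → k)) (r : C → ℕ)

/-- The `m`-th step of the filtration attached to the pieces `W c` and the rank function `r`,
seen from the piece `c`: the sum of the pieces of rank at least `r c + m`. [folklore] -/
def stepFiltration (m : ℕ) (c : C) : Submodule k (n → k) :=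
  ⨆ c' : {c' : C // r c + m ≤ r c'}, W c'.1

variable {W r}

/-- A piece of rank `≥ r c + m` lies in the `m`-th filtration step seen from `c`. [folklore] -/
lemma le_stepFiltration {m : ℕ} {c c' : C} (h : r c + m ≤ r c') :
    W c' ≤ stepFiltration W r m c :=
  le_iSup_of_le (f := fun c'' : {c'' : C // r c + m ≤ r c''} => W c''.1) ⟨c', h⟩ le_rfl

/-- The filtration steps decrease with `m`. [folklore] -/
lemma stepFiltration_anti {m m' : ℕ} (h : m ≤ m') (c : C) :
    stepFiltration W r m' c ≤ stepFiltration W r m c :=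
  iSup_le fun c' => le_stepFiltration (le_trans (Nat.add_le_add_left h _) c'.2)

/-- Transitivity of the steps: the `b`-th step seen from a piece of rank `≥ r c + a` lies in the
`(b + a)`-th step seen from `c`. [folklore] -/
lemma stepFiltration_le {a b : ℕ} {c c' : C} (h : r c + a ≤ r c') :
    stepFiltration W r b c' ≤ stepFiltration W r (b + a) c :=
  iSup_le fun c'' => le_stepFiltration (by have := c''.2; omega)

variable [Fintype n]

variable (W r) in
/-- The matrices raising the rank by at least `m`: `x (W c) ⊆ ⨆_{r c' ≥ r c + m} W c'` for every
piece `c`. [folklore] -/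
def raising (m : ℕ) : Submodule k (Matrix n n k) where
  carrier := {x | ∀ c, ∀ v ∈ W c, x.mulVec v ∈ stepFiltration W r m c}
  zero_mem' := by
    intro c v _
    simp
  add_mem' := by
    intro x y hx hy c v hv
    rw [Matrix.add_mulVec]
    exact add_mem (hx c v hv) (hy c v hv)
  smul_mem' := by
    intro a x hx c v hv
    rw [Matrix.smul_mulVec]
    exact Submodule.smul_mem _ a (hx c v hv)

/-- Membership in `raising W r m`. [folklore] -/
lemma mem_raising_iff {m : ℕ} {x : Matrix n n k} :
    x ∈ raising W r m ↔ ∀ c, ∀ v ∈ W c, x.mulVec v ∈ stepFiltration W r m c := Iff.rfl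

/-- A matrix raising the rank by `a` maps the `b`-th step into the `(a + b)`-th step. [folklore] -/
lemma mulVec_mem_stepFiltration {a b : ℕ} {x : Matrix n n k} (hx : x ∈ raising W r a) {c : C}
    {v : n → k} (hv : v ∈ stepFiltration W r b c) :
    x.mulVec v ∈ stepFiltration W r (a + b) c := by
  refine Submodule.iSup_induction (motive := fun v => x.mulVec v ∈ stepFiltration W r (a + b) c)
    _ hv (fun c' v hv => stepFiltration_le (a := b) (b := a) c'.2 (hx c'.1 v hv)) ?_
    fun v w hv hw => ?_
  · rw [Matrix.mulVec_zero]
    exact zero_mem _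
  · rw [Matrix.mulVec_add]
    exact add_mem hv hw

/-- `n_a · n_b ⊆ n_{a+b}` for the raising matrices `n_m = raising W r m`. [folklore] -/
lemma raising_mul_mem {a b : ℕ} {x y : Matrix n n k} (hx : x ∈ raising W r a)
    (hy : y ∈ raising W r b) : x * y ∈ raising W r (a + b) := by
  intro c v hv
  rw [← Matrix.mulVec_mulVec]
  exact mulVec_mem_stepFiltration hx (hy c v hv)

/-- `n_b ⊆ n_a` for `a ≤ b`. [folklore] -/
lemma raising_anti {a b : ℕ} (h : a ≤ b) : raising W r b ≤ raising W r a :=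
  fun _ hx c v hv => stepFiltration_anti h c (hx c v hv)

/-- `n_a · n_b ⊆ n_a`. [folklore] -/
lemma raising_mul_mem_left {a b : ℕ} {x y : Matrix n n k} (hx : x ∈ raising W r a)
    (hy : y ∈ raising W r b) : x * y ∈ raising W r a :=
  raising_anti (Nat.le_add_right a b) (raising_mul_mem hx hy)

/-- `n_a · n_b ⊆ n_b`. [folklore] -/
lemma raising_mul_mem_right {a b : ℕ} {x y : Matrix n n k} (hx : x ∈ raising W r a)
    (hy : y ∈ raising W r b) : x * y ∈ raising W r b :=
  raising_anti (Nat.le_add_left b a) (raising_mul_mem hx hy)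

variable (W) in
/-- The *block scalar* matrices: those acting on every piece `W c` by a scalar. [folklore] -/
def blockScalar : Set (Matrix n n k) :=
  {d | ∀ c, ∃ a : k, ∀ v ∈ W c, d.mulVec v = a • v}

/-- Block scalar matrices are closed under multiplication. [folklore] -/
lemma blockScalar_mul_mem {d d' : Matrix n n k} (hd : d ∈ blockScalar W)
    (hd' : d' ∈ blockScalar W) : d * d' ∈ blockScalar W := by
  intro c
  obtain ⟨a, ha⟩ := hd c
  obtain ⟨a', ha'⟩ := hd' c
  refine ⟨a * a', fun v hv => ?_⟩
  rw [← Matrix.mulVec_mulVec, ha' v hv, Matrix.mulVec_smul, ha v hv, smul_smul, mul_comm]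

/-- Block scalar matrices commute modulo every `n_m` (indeed on every piece, hence exactly when the
pieces span; only this weak form is needed). [folklore] -/
lemma blockScalar_comm_sub_mem {d d' : Matrix n n k} (hd : d ∈ blockScalar W)
    (hd' : d' ∈ blockScalar W) (m : ℕ) : d * d' - d' * d ∈ raising W r m := by
  intro c v hv
  obtain ⟨a, ha⟩ := hd c
  obtain ⟨a', ha'⟩ := hd' c
  have h0 : (d * d' - d' * d).mulVec v = 0 := by
    rw [Matrix.sub_mulVec, ← Matrix.mulVec_mulVec, ← Matrix.mulVec_mulVec, ha' v hv, ha v hv,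
      Matrix.mulVec_smul, Matrix.mulVec_smul, ha v hv, ha' v hv, smul_smul, smul_smul, mul_comm,
      sub_self]
  rw [h0]
  exact zero_mem _

/-- A block scalar matrix preserves every piece. [folklore] -/
lemma blockScalar_mulVec_mem {d : Matrix n n k} (hd : d ∈ blockScalar W) {c : C} {v : n → k}
    (hv : v ∈ W c) : d.mulVec v ∈ W c := by
  obtain ⟨a, ha⟩ := hd c
  rw [ha v hv]
  exact Submodule.smul_mem _ a hv

/-- A block scalar matrix preserves every filtration step. [folklore] -/
lemma blockScalar_mulVec_mem_stepFiltration {d : Matrix n n k} (hd : d ∈ blockScalar W) {m : ℕ}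
    {c : C} {v : n → k} (hv : v ∈ stepFiltration W r m c) :
    d.mulVec v ∈ stepFiltration W r m c := by
  refine Submodule.iSup_induction (motive := fun v => d.mulVec v ∈ stepFiltration W r m c)
    _ hv (fun c' v hv => le_stepFiltration c'.2 (blockScalar_mulVec_mem hd hv)) ?_
    fun v w hv hw => ?_
  · rw [Matrix.mulVec_zero]
    exact zero_mem _
  · rw [Matrix.mulVec_add]
    exact add_mem hv hw

/-- `D · n_m ⊆ n_m` for the block scalar matrices `D`. [folklore] -/
lemma blockScalar_mul_raising {d x : Matrix n n k} (hd : d ∈ blockScalar W) {m : ℕ}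
    (hx : x ∈ raising W r m) : d * x ∈ raising W r m := by
  intro c v hv
  rw [← Matrix.mulVec_mulVec]
  exact blockScalar_mulVec_mem_stepFiltration hd (hx c v hv)

/-- `n_m · D ⊆ n_m` for the block scalar matrices `D`. [folklore] -/
lemma raising_mul_blockScalar {d x : Matrix n n k} {m : ℕ} (hx : x ∈ raising W r m)
    (hd : d ∈ blockScalar W) : x * d ∈ raising W r m := by
  intro c v hv
  obtain ⟨a, ha⟩ := hd c
  rw [← Matrix.mulVec_mulVec, ha v hv, Matrix.mulVec_smul]
  exact Submodule.smul_mem _ a (hx c v hv)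

variable (W r) in
/-- The *level algebra*: block scalar matrices plus rank-raising ones. [folklore] -/
def levelAlg : Set (Matrix n n k) :=
  {x | ∃ d ∈ blockScalar W, x - d ∈ raising W r 1}

/-- Block scalar matrices lie in the level algebra. [folklore] -/
lemma mem_levelAlg_of_mem_blockScalar {d : Matrix n n k} (hd : d ∈ blockScalar W) :
    d ∈ levelAlg W r :=
  ⟨d, hd, by simp⟩

/-- The level algebra `A = D + n₁` is closed under multiplication. [folklore] -/
lemma levelAlg_mul_mem {x y : Matrix n n k} (hx : x ∈ levelAlg W r) (hy : y ∈ levelAlg W r) :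
    x * y ∈ levelAlg W r := by
  obtain ⟨d, hd, hxd⟩ := hx
  obtain ⟨d', hd', hyd⟩ := hy
  refine ⟨d * d', blockScalar_mul_mem hd hd', ?_⟩
  have e : x * y - d * d' = (x - d) * (y - d') + d * (y - d') + (x - d) * d' := by noncomm_ring
  rw [e]
  exact add_mem (add_mem (raising_mul_mem_left hxd hyd) (blockScalar_mul_raising hd hyd))
    (raising_mul_blockScalar hxd hd')

/-- The level algebra is commutative modulo `n₁`: `[A, A] ⊆ n₁`. [folklore] -/
lemma levelAlg_comm_sub_mem {x y : Matrix n n k} (hx : x ∈ levelAlg W r) (hy : y ∈ levelAlg W r) :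
    x * y - y * x ∈ raising W r 1 := by
  obtain ⟨d, hd, hxd⟩ := hx
  obtain ⟨d', hd', hyd⟩ := hy
  have e : x * y - y * x = (d * d' - d' * d) + (d * (y - d') - (y - d') * d) +
      ((x - d) * d' - d' * (x - d)) + ((x - d) * (y - d') - (y - d') * (x - d)) := by
    noncomm_ring
  rw [e]
  refine add_mem (add_mem (add_mem (blockScalar_comm_sub_mem hd hd' 1) (sub_mem ?_ ?_))
    (sub_mem ?_ ?_)) (sub_mem ?_ ?_)
  · exact blockScalar_mul_raising hd hyd
  · exact raising_mul_blockScalar hyd hd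
  · exact raising_mul_blockScalar hxd hd'
  · exact blockScalar_mul_raising hd' hxd
  · exact raising_mul_mem_left hxd hyd
  · exact raising_mul_mem_left hyd hxd

/-- `A · n_m ⊆ n_m`: each `n_m` is a left ideal of the level algebra. [folklore] -/
lemma levelAlg_mul_raising {x y : Matrix n n k} (hx : x ∈ levelAlg W r) {m : ℕ}
    (hy : y ∈ raising W r m) : x * y ∈ raising W r m := by
  obtain ⟨d, hd, hxd⟩ := hx
  have e : x * y = (x - d) * y + d * y := by noncomm_ring
  rw [e]
  exact add_mem (raising_mul_mem_right hxd hy) (blockScalar_mul_raising hd hy)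

/-- `n_m · A ⊆ n_m`: each `n_m` is a right ideal of the level algebra. [folklore] -/
lemma raising_mul_levelAlg {x y : Matrix n n k} {m : ℕ} (hx : x ∈ raising W r m)
    (hy : y ∈ levelAlg W r) : x * y ∈ raising W r m := by
  obtain ⟨d, hd, hyd⟩ := hy
  have e : x * y = x * (y - d) + x * d := by noncomm_ring
  rw [e]
  exact add_mem (raising_mul_mem_left hx hyd) (raising_mul_blockScalar hx hd)

variable [DecidableEq n]

/-- `1` is block scalar. [folklore] -/
lemma one_mem_blockScalar : (1 : Matrix n n k) ∈ blockScalar W :=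
  fun _ => ⟨1, fun v _ => by simp⟩

/-- `1` lies in the level algebra. [folklore] -/
lemma one_mem_levelAlg : (1 : Matrix n n k) ∈ levelAlg W r :=
  mem_levelAlg_of_mem_blockScalar one_mem_blockScalar

/-- `1 + n_m ⊆ A` for `m ≥ 1`. [folklore] -/
lemma mem_levelAlg_of_sub_one_mem {x : Matrix n n k} {m : ℕ} (hm : 1 ≤ m)
    (hx : x - 1 ∈ raising W r m) : x ∈ levelAlg W r :=
  ⟨1, one_mem_blockScalar, raising_anti hm hx⟩

/-- `n_m · (1 + n_a) ⊆ n_m`. [folklore] -/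
lemma raising_mul_of_sub_one_mem {x g : Matrix n n k} {m a : ℕ} (hx : x ∈ raising W r m)
    (hg : g - 1 ∈ raising W r a) : x * g ∈ raising W r m := by
  have e : x * g = x + x * (g - 1) := by noncomm_ring
  rw [e]
  exact add_mem hx (raising_mul_mem_left hx hg)

variable (W r) in
/-- The *level group*: invertible matrices lying, with their inverses, in the level algebra.
[folklore] -/
def levelGroup : Subgroup (GL n k) where
  carrier := {g | (g : Matrix n n k) ∈ levelAlg W r ∧
    ((g⁻¹ : GL n k) : Matrix n n k) ∈ levelAlg W r}
  one_mem' := ⟨by simpa using one_mem_levelAlg, by simpa using one_mem_levelAlg⟩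
  mul_mem' := by
    rintro g h ⟨hg, hg'⟩ ⟨hh, hh'⟩
    refine ⟨?_, ?_⟩
    · rw [Units.val_mul]
      exact levelAlg_mul_mem hg hh
    · rw [mul_inv_rev, Units.val_mul]
      exact levelAlg_mul_mem hh' hg'
  inv_mem' := by
    rintro g ⟨hg, hg'⟩
    exact ⟨hg', by simpa using hg⟩

/-- Membership in the level group. [folklore] -/
lemma mem_levelGroup_iff {g : GL n k} :
    g ∈ levelGroup W r ↔
      (g : Matrix n n k) ∈ levelAlg W r ∧ ((g⁻¹ : GL n k) : Matrix n n k) ∈ levelAlg W r :=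
  Iff.rfl

variable (W r) in
/-- The subgroup of invertible matrices congruent to `1` modulo the rank-`m`-raising matrices.
[folklore] -/
def raisingGroup (m : ℕ) : Subgroup (GL n k) where
  carrier := {g | (g : Matrix n n k) - 1 ∈ raising W r m ∧
    ((g⁻¹ : GL n k) : Matrix n n k) - 1 ∈ raising W r m}
  one_mem' := by simp
  mul_mem' := by
    rintro g h ⟨hg, hg'⟩ ⟨hh, hh'⟩
    refine ⟨?_, ?_⟩
    · rw [Units.val_mul]
      have e : (g : Matrix n n k) * h - 1 = (g - 1) * (h - 1) + (g - 1) + (h - 1) := by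
        noncomm_ring
      rw [e]
      exact add_mem (add_mem (raising_mul_mem_left hg hh) hg) hh
    · rw [mul_inv_rev, Units.val_mul]
      have e : ((h⁻¹ : GL n k) : Matrix n n k) * ((g⁻¹ : GL n k) : Matrix n n k) - 1 =
          (((h⁻¹ : GL n k) : Matrix n n k) - 1) * (((g⁻¹ : GL n k) : Matrix n n k) - 1) +
            (((h⁻¹ : GL n k) : Matrix n n k) - 1) + (((g⁻¹ : GL n k) : Matrix n n k) - 1) := by
        noncomm_ring
      rw [e]
      exact add_mem (add_mem (raising_mul_mem_left hh' hg') hh') hg'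
  inv_mem' := by
    rintro g ⟨hg, hg'⟩
    exact ⟨hg', by simpa using hg⟩

/-- Membership in the `m`-th raising group `U_m = GL_n ∩ (1 + n_m)`. [folklore] -/
lemma mem_raisingGroup_iff {m : ℕ} {g : GL n k} :
    g ∈ raisingGroup W r m ↔ (g : Matrix n n k) - 1 ∈ raising W r m ∧
      ((g⁻¹ : GL n k) : Matrix n n k) - 1 ∈ raising W r m :=
  Iff.rfl

/-- `U_b ≤ U_a` for `a ≤ b`. [folklore] -/
lemma raisingGroup_anti {a b : ℕ} (h : a ≤ b) : raisingGroup W r b ≤ raisingGroup W r a :=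
  fun _ hg => ⟨raising_anti h hg.1, raising_anti h hg.2⟩

/-- `U_m ≤ Q` (the level group) for `m ≥ 1`. [folklore] -/
lemma raisingGroup_le_levelGroup {m : ℕ} (hm : 1 ≤ m) : raisingGroup W r m ≤ levelGroup W r :=
  fun _ hg => ⟨mem_levelAlg_of_sub_one_mem hm hg.1, mem_levelAlg_of_sub_one_mem hm hg.2⟩

/-- `g h g⁻¹ h⁻¹ - 1 = (g h - h g) g⁻¹ h⁻¹`. [folklore] -/
lemma coe_commutatorElement_sub_one (g h : GL n k) :
    ((g * h * g⁻¹ * h⁻¹ : GL n k) : Matrix n n k) - 1 =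
      ((g : Matrix n n k) * h - h * g) * ((g⁻¹ : GL n k) : Matrix n n k) *
        ((h⁻¹ : GL n k) : Matrix n n k) := by
  have hg : (g : Matrix n n k) * ((g⁻¹ : GL n k) : Matrix n n k) = 1 := by
    rw [← Units.val_mul, mul_inv_cancel, Units.val_one]
  have hh : (h : Matrix n n k) * ((h⁻¹ : GL n k) : Matrix n n k) = 1 := by
    rw [← Units.val_mul, mul_inv_cancel, Units.val_one]
  have e : (h : Matrix n n k) * g * ((g⁻¹ : GL n k) : Matrix n n k) *
      ((h⁻¹ : GL n k) : Matrix n n k) = 1 := by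
    rw [mul_assoc (h : Matrix n n k), hg, mul_one, hh]
  simp only [Units.val_mul]
  rw [sub_mul, sub_mul, e]

/-- Commutators of the level group lie in `U₁`: `(Q, Q) ⊆ U₁`, because `[A, A] ⊆ n₁` is a two-sided
ideal. [folklore] -/
lemma commutatorElement_mem_raisingGroup_one {g h : GL n k} (hg : g ∈ levelGroup W r)
    (hh : h ∈ levelGroup W r) : g * h * g⁻¹ * h⁻¹ ∈ raisingGroup W r 1 := by
  refine ⟨?_, ?_⟩
  · rw [coe_commutatorElement_sub_one]
    exact raising_mul_levelAlg (raising_mul_levelAlg (levelAlg_comm_sub_mem hg.1 hh.1) hg.2) hh.2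
  · have e : (g * h * g⁻¹ * h⁻¹)⁻¹ = h * g * h⁻¹ * g⁻¹ := by group
    rw [e, coe_commutatorElement_sub_one]
    exact raising_mul_levelAlg (raising_mul_levelAlg (levelAlg_comm_sub_mem hh.1 hg.1) hh.2) hg.2

/-- `(U_a, U_b) ⊆ U_{a+b}`: for `g = 1 + x`, `h = 1 + y`, `g h - h g = x y - y x ∈ n_{a+b}`.
[folklore] -/
lemma commutatorElement_mem_raisingGroup_add {a b : ℕ} {g h : GL n k}
    (hg : g ∈ raisingGroup W r a) (hh : h ∈ raisingGroup W r b) :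
    g * h * g⁻¹ * h⁻¹ ∈ raisingGroup W r (a + b) := by
  have key : ∀ {a b : ℕ} {g h : GL n k}, g ∈ raisingGroup W r a → h ∈ raisingGroup W r b →
      ((g * h * g⁻¹ * h⁻¹ : GL n k) : Matrix n n k) - 1 ∈ raising W r (a + b) := by
    intro a b g h hg hh
    rw [coe_commutatorElement_sub_one]
    have e : (g : Matrix n n k) * h - h * g = (g - 1) * (h - 1) - (h - 1) * (g - 1) := by
      noncomm_ring
    rw [e]
    refine raising_mul_of_sub_one_mem (raising_mul_of_sub_one_mem (sub_mem ?_ ?_) hg.2) hh.2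
    · exact raising_mul_mem hg.1 hh.1
    · rw [add_comm]
      exact raising_mul_mem hh.1 hg.1
  refine ⟨key hg hh, ?_⟩
  have e : (g * h * g⁻¹ * h⁻¹)⁻¹ = h * g * h⁻¹ * g⁻¹ := by group
  rw [e, add_comm]
  exact key hh hg

/-- The derived series of the level group descends the filtration by the raising groups.
[folklore] -/
lemma map_derivedSeries_succ_le (i : ℕ) :
    (derivedSeries (↥(levelGroup W r)) (i + 1)).map (levelGroup W r).subtype ≤
      raisingGroup W r (i + 1) := by
  induction i with
  | zero =>
    rw [derivedSeries_succ, derivedSeries_zero, Subgroup.map_commutator, ← MonoidHom.range_eq_map,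
      Subgroup.range_subtype, Subgroup.commutator_le]
    intro g hg h hh
    exact commutatorElement_mem_raisingGroup_one hg hh
  | succ i ih =>
    rw [derivedSeries_succ, Subgroup.map_commutator]
    refine (Subgroup.commutator_mono ih ih).trans ?_
    rw [Subgroup.commutator_le]
    intro g hg h hh
    exact raisingGroup_anti (by omega) (commutatorElement_mem_raisingGroup_add hg hh)

/-- If every rank is `< B` and the pieces span, nothing raises the rank by `B`. [folklore] -/
lemma raising_eq_bot {B : ℕ} (hr : ∀ c, r c < B) (hW : ⨆ c, W c = ⊤) : raising W r B = ⊥ := by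
  rw [eq_bot_iff]
  intro x hx
  have h0 : ∀ c, stepFiltration W r B c = ⊥ := fun c => by
    rw [eq_bot_iff]
    refine iSup_le fun c' => ?_
    exfalso
    have h1 := c'.2
    have h2 := hr c'.1
    omega
  have hv : ∀ v, x.mulVec v = 0 := by
    intro v
    have hv : v ∈ ⨆ c, W c := by rw [hW]; trivial
    refine Submodule.iSup_induction (motive := fun v => x.mulVec v = 0) _ hv (fun c v hv => ?_)
      (Matrix.mulVec_zero _) fun v w hv hw => by rw [Matrix.mulVec_add, hv, hw, add_zero]
    have h := hx c v hv
    rwa [h0 c, Submodule.mem_bot] at h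
  have h : Matrix.toLin' x = 0 := LinearMap.ext fun v => by simp [hv]
  rw [Submodule.mem_bot]
  simpa using h

/-- If every rank is `< B` and the pieces span then `U_B = 1`. [folklore] -/
lemma raisingGroup_eq_bot {B : ℕ} (hr : ∀ c, r c < B) (hW : ⨆ c, W c = ⊤) :
    raisingGroup W r B = ⊥ := by
  rw [eq_bot_iff]
  rintro g ⟨hg, -⟩
  rw [raising_eq_bot hr hW, Submodule.mem_bot, sub_eq_zero] at hg
  rw [Subgroup.mem_bot]
  exact Units.ext hg

/-- **The level group is solvable** when the ranks are bounded and the pieces span. [folklore] -/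
theorem isSolvable_levelGroup {B : ℕ} (hr : ∀ c, r c < B) (hW : ⨆ c, W c = ⊤) :
    IsSolvable ↥(levelGroup W r) := by
  refine ⟨⟨B + 1, ?_⟩⟩
  have h := map_derivedSeries_succ_le (W := W) (r := r) B
  have h' : raisingGroup W r (B + 1) = ⊥ := by
    rw [eq_bot_iff, ← raisingGroup_eq_bot hr hW]
    exact raisingGroup_anti (Nat.le_succ B)
  rw [h', le_bot_iff, Subgroup.map_eq_bot_iff_of_injective _ (Subgroup.subtype_injective _)] at h
  exact h

/-- Subgroups of the level group are solvable. [folklore] -/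
theorem isSolvable_of_le_levelGroup {B : ℕ} (hr : ∀ c, r c < B) (hW : ⨆ c, W c = ⊤)
    {H : Subgroup (GL n k)} (hH : H ≤ levelGroup W r) : IsSolvable ↥H :=
  haveI := isSolvable_levelGroup hr hW
  solvable_of_solvable_injective (Subgroup.inclusion_injective hH)

end LevelAlgebra

/-! ### Ranks from a strict partial order on a finite type -/

section Rank

variable {C : Type*} [Fintype C] (lt : C → C → Prop)

/-- The rank of `c`: the number of elements strictly below it. [folklore] -/
def rankOf (c : C) : ℕ := by
  classical exact (Finset.univ.filter fun c'' => lt c'' c).card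

/-- Ranks are bounded by the cardinality of the type. [folklore] -/
lemma rankOf_lt (c : C) : rankOf lt c < Fintype.card C + 1 := by
  classical
  unfold rankOf
  exact Nat.lt_succ_of_le ((Finset.card_filter_le _ _).trans (Finset.card_univ (α := C)).le)

variable {lt}

/-- For a transitive irreflexive relation the rank is strictly monotone: the elements below `c` are
below `c'`, and `c` itself is below `c'` but not below `c`. [folklore] -/
lemma rankOf_lt_rankOf (htrans : ∀ a b c, lt a b → lt b c → lt a c) (hirr : ∀ a, ¬ lt a a)
    {c c' : C} (h : lt c c') : rankOf lt c < rankOf lt c' := by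
  classical
  unfold rankOf
  apply Finset.card_lt_card
  rw [Finset.ssubset_iff_of_subset]
  · exact ⟨c, by simp [h], by simp [hirr]⟩
  · intro x hx
    simp only [Finset.mem_filter, Finset.mem_univ, true_and] at hx ⊢
    exact htrans _ _ _ hx h

end Rank


/-! ### Weights of a commutative group of semisimple matrices -/

section TorusWeights

variable [Fintype n] [DecidableEq n] {T : Subgroup (GL n k)}

variable (T) in
/-- The weight space `V_χ = {v ∈ kⁿ | t v = χ(t) v, t ∈ T}` of an algebraic character `χ ∈ X*(T)`
(`weightSpace` of `DiagonalizableGroups.lean` at the function underlying `χ`). [folklore] -/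
abbrev charWeightSpace (χ : ↥(characterLattice T)) : Submodule k (n → k) :=
  weightSpace T fun t => ((χ : ↥T →* kˣ) t : k)

variable (T) in
/-- The *weights* of `T` on `kⁿ`: the algebraic characters with non-zero weight space.
[folklore] -/
abbrev Weights : Type _ := {χ : ↥(characterLattice T) // charWeightSpace T χ ≠ ⊥}

/-- The simultaneous eigenspaces `V_w` (`w : T → k`) of a commutative `T ≤ GL n k` are
independent (Mathlib: simultaneous generalised eigenspaces of a commuting family are
independent). [folklore] -/
lemma iSupIndep_weightSpace [IsMulCommutative ↥T] :
    iSupIndep fun w : ↥T → k => weightSpace T w := by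
  let f : ↥T → Module.End k (n → k) := fun t => Matrix.toLin' ((t : GL n k) : Matrix n n k)
  have hcomm : ∀ s t : ↥T, Commute (f s) (f t) := by
    intro s t
    have hst : ((s : GL n k) : Matrix n n k) * ((t : GL n k) : Matrix n n k) =
        ((t : GL n k) : Matrix n n k) * ((s : GL n k) : Matrix n n k) := by
      have h := congrArg (fun x : ↥T => ((x : GL n k) : Matrix n n k)) (mul_comm s t)
      simpa only [Subgroup.coe_mul, Units.val_mul] using h
    change f s * f t = f t * f s
    simp only [f]
    rw [Module.End.mul_eq_comp, Module.End.mul_eq_comp, ← Matrix.toLin'_mul, ← Matrix.toLin'_mul,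
      hst]
  have h := Module.End.independent_iInf_maxGenEigenspace_of_forall_mapsTo f
    fun i j φ => Module.End.mapsTo_maxGenEigenspace_of_comm (hcomm j i) φ
  refine h.mono fun w => ?_
  change (⨅ t : ↥T, Module.End.eigenspace (f t) (w t)) ≤ _
  exact iInf_mono fun t => Module.End.eigenspace_le_maxGenEigenspace

/-- An algebraic character is determined by its underlying function `T → k`. [folklore] -/
lemma injective_coeFn_characterLattice :
    Function.Injective fun χ : ↥(characterLattice T) => fun t : ↥T => ((χ : ↥T →* kˣ) t : k) := by
  intro χ χ' h
  apply Subtype.ext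
  ext t
  exact congrFun h t

/-- The weight spaces of distinct algebraic characters are independent. [folklore] -/
lemma iSupIndep_charWeightSpace [IsMulCommutative ↥T] : iSupIndep (charWeightSpace T) :=
  (iSupIndep_weightSpace (T := T)).comp injective_coeFn_characterLattice

/-- There are finitely many weights (independent non-zero subspaces of `kⁿ`). [folklore] -/
noncomputable instance fintypeWeights [IsMulCommutative ↥T] : Fintype (Weights T) :=
  (iSupIndep_charWeightSpace (T := T)).fintypeNeBotOfFiniteDimensional

/-- **Simultaneous diagonalisation** in character form (Springer 2.4.2 (ii), 3.2.3): over an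
algebraically closed field, if `T` is commutative and consists of semisimple elements then `kⁿ`
is the sum of the weight spaces of its weights. [cite: SpringerLAG1998, 2.4.2 (ii)] -/
lemma iSup_charWeightSpace_eq_top [IsAlgClosed k] [IsMulCommutative ↥T]
    (hs : ∀ t ∈ T, IsSemisimpleElt t) :
    ⨆ c : Weights T, charWeightSpace T c.1 = ⊤ := by
  rw [eq_top_iff, ← iSup_weightSpace_eq_top hs]
  refine iSup_le fun w => ?_
  by_cases hw : weightSpace T w = ⊥
  · rw [hw]
    exact bot_le
  · obtain ⟨v, hv, hv0⟩ := (Submodule.ne_bot_iff _).mp hw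
    let χ : ↥(characterLattice T) := ⟨weightChar hv hv0, isAlgebraicChar_weightChar hv hv0⟩
    have e : charWeightSpace T χ = weightSpace T w := rfl
    exact le_iSup_of_le (f := fun c : Weights T => charWeightSpace T c.1) ⟨χ, by rwa [e]⟩ e.ge

/-- Elements of `T` are block scalar for the weight decomposition: `t` acts on `V_χ` by `χ(t)`.
[folklore] -/
lemma coe_mem_blockScalar_weights {t : GL n k} (ht : t ∈ T) :
    (t : Matrix n n k) ∈ blockScalar (fun c : Weights T => charWeightSpace T c.1) :=
  fun c => ⟨((c.1 : ↥T →* kˣ) ⟨t, ht⟩ : k), fun _ hv => (mem_weightSpace_iff.mp hv) ⟨t, ht⟩⟩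

/-- `T` lies in the level group of its weight decomposition, for any rank function. [folklore] -/
theorem le_levelGroup_weights (r : Weights T → ℕ) :
    T ≤ levelGroup (fun c : Weights T => charWeightSpace T c.1) r :=
  fun _ ht => ⟨mem_levelAlg_of_mem_blockScalar (coe_mem_blockScalar_weights ht),
    mem_levelAlg_of_mem_blockScalar (coe_mem_blockScalar_weights (inv_mem ht))⟩

end TorusWeights

/-! ### Coefficient matrices of an algebraic homomorphism `𝔾ₐ → G` normalised by `T` -/

section AddHomCoeff

open Polynomial

variable [Fintype n] [DecidableEq n] {G T : Subgroup (GL n k)} {u : Multiplicative k →* ↥G}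

/-- The matrix of `j`-th coefficients of the entry polynomials `P_{ab}` of an algebraic
homomorphism `u : 𝔾ₐ → G`, `u(x)_{ab} = P_{ab}(x)`: so `u(x) = ∑ⱼ xʲ Aⱼ`. [folklore] -/
def coeffMatrix (Pu : GLCoord n → k[X]) (j : ℕ) : Matrix n n k :=
  Matrix.of fun a b => (Pu (Sum.inl (a, b))).coeff j

/-- A strict bound for the degrees of the entry polynomials. [folklore] -/
def coeffBound (Pu : GLCoord n → k[X]) : ℕ :=
  (Finset.univ.sup fun ab : n × n => (Pu (Sum.inl ab)).natDegree) + 1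

variable {Pu : GLCoord n → k[X]}
  (hPu : ∀ (x : k) (c : GLCoord n),
    glCoordFun ((u (Multiplicative.ofAdd x) : ↥G) : GL n k) c = (Pu c).eval x)
include hPu

/-- `u(x) = ∑_{j < N} xʲ Aⱼ` with `N = coeffBound`. [folklore] -/
lemma coe_eq_sum_coeffMatrix (x : k) :
    (((u (Multiplicative.ofAdd x) : ↥G) : GL n k) : Matrix n n k) =
      ∑ j ∈ Finset.range (coeffBound Pu), x ^ j • coeffMatrix Pu j := by
  ext a b
  have h := hPu x (Sum.inl (a, b))
  rw [glCoordFun_inl] at h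
  rw [h, Polynomial.eval_eq_sum_range' (n := coeffBound Pu)]
  · simp [coeffMatrix, Matrix.sum_apply, mul_comm]
  · exact Nat.lt_succ_of_le
      (Finset.le_sup (f := fun ab : n × n => (Pu (Sum.inl ab)).natDegree) (Finset.mem_univ (a, b)))

/-- `A₀ = u(0) = 1`. [folklore] -/
lemma coeffMatrix_zero : coeffMatrix Pu 0 = 1 := by
  ext a b
  have h := hPu 0 (Sum.inl (a, b))
  rw [glCoordFun_inl, ofAdd_zero, map_one] at h
  rw [coeffMatrix, Matrix.of_apply, Polynomial.coeff_zero_eq_eval_zero, ← h]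
  simp

/-- `u(x) - 1 = ∑_{j < N - 1} x^{j+1} A_{j+1}`. [folklore] -/
lemma coe_sub_one_eq_sum_coeffMatrix (x : k) :
    (((u (Multiplicative.ofAdd x) : ↥G) : GL n k) : Matrix n n k) - 1 =
      ∑ j ∈ Finset.range (coeffBound Pu - 1), x ^ (j + 1) • coeffMatrix Pu (j + 1) := by
  rw [coe_eq_sum_coeffMatrix hPu x, sub_eq_iff_eq_add]
  have hN : coeffBound Pu = (coeffBound Pu - 1) + 1 := by unfold coeffBound; omega
  conv_lhs => rw [hN, Finset.sum_range_succ']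
  rw [pow_zero, one_smul, coeffMatrix_zero hPu]

/-- **Equivariance of the coefficients.** If `t u(x) t⁻¹ = u(α(t) x)` for `t ∈ T`, then
`t Aⱼ t⁻¹ = α(t)ʲ Aⱼ`: `Aⱼ` is a weight vector of weight `αʲ` for `Ad T` (comparison of
coefficients over an infinite field; Springer 8.1.1 (i) for `j = 1`). [folklore] -/
lemma conj_coeffMatrix [Infinite k] {hTG : T ≤ G} {α : ↥T →* kˣ}
    (hconj : ∀ (t : ↥T) (x : k),
      Subgroup.inclusion hTG t * u (Multiplicative.ofAdd x) * (Subgroup.inclusion hTG t)⁻¹ =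
        u (Multiplicative.ofAdd ((α t : k) * x)))
    (t : ↥T) (j : ℕ) :
    ((t : GL n k) : Matrix n n k) * coeffMatrix Pu j * ((t : GL n k) : Matrix n n k)⁻¹ =
      ((α t : kˣ) : k) ^ j • coeffMatrix Pu j := by
  have hentry : ∀ (x : k) (a b : n),
      (((u (Multiplicative.ofAdd x) : ↥G) : GL n k) : Matrix n n k) a b =
        (Pu (Sum.inl (a, b))).eval x :=
    fun x a b => by simpa using hPu x (Sum.inl (a, b))
  ext i j'
  have hpoly : (∑ b, (∑ a, C (((t : GL n k) : Matrix n n k) i a) * Pu (Sum.inl (a, b))) *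
        C (((t : GL n k) : Matrix n n k)⁻¹ b j')) =
      (Pu (Sum.inl (i, j'))).comp (C ((α t : kˣ) : k) * X) := by
    apply Polynomial.funext
    intro x
    have h := congrArg (fun g : ↥G => ((g : GL n k) : Matrix n n k) i j') (hconj t x)
    simp only [Subgroup.coe_mul, Subgroup.coe_inv, Subgroup.coe_inclusion, Units.val_mul,
      Matrix.coe_units_inv, Matrix.mul_apply, hentry] at h
    simpa only [Polynomial.eval_finsetSum, Polynomial.eval_mul, Polynomial.eval_C,
      Polynomial.eval_comp, Polynomial.eval_X] using h
  have hcoeff := congrArg (fun p : k[X] => p.coeff j) hpoly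
  simp only [Polynomial.finsetSum_coeff, Polynomial.coeff_mul_C, Polynomial.coeff_C_mul,
    Polynomial.comp_C_mul_X_coeff] at hcoeff
  simp only [Matrix.mul_apply, Matrix.smul_apply, coeffMatrix, Matrix.of_apply, smul_eq_mul]
  rw [mul_comm (((α t : kˣ) : k) ^ j), ← hcoeff]

/-- Hence `t Aⱼ = α(t)ʲ Aⱼ t`. [folklore] -/
lemma mul_coeffMatrix [Infinite k] {hTG : T ≤ G} {α : ↥T →* kˣ}
    (hconj : ∀ (t : ↥T) (x : k),
      Subgroup.inclusion hTG t * u (Multiplicative.ofAdd x) * (Subgroup.inclusion hTG t)⁻¹ =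
        u (Multiplicative.ofAdd ((α t : k) * x)))
    (t : ↥T) (j : ℕ) :
    ((t : GL n k) : Matrix n n k) * coeffMatrix Pu j =
      ((α t : kˣ) : k) ^ j • (coeffMatrix Pu j * ((t : GL n k) : Matrix n n k)) := by
  have h := congrArg (fun M => M * ((t : GL n k) : Matrix n n k)) (conj_coeffMatrix hPu hconj t j)
  rwa [Matrix.smul_mul, mul_assoc, Matrix.nonsing_inv_mul _ (Matrix.isUnits_det_units _),
    mul_one] at h

/-- **The coefficients shift weights by powers of `α`**: `Aⱼ (V_χ) ⊆ V_{χ αʲ}`. [folklore] -/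
lemma coeffMatrix_mulVec_mem [Infinite k] {hTG : T ≤ G} {α : ↥(characterLattice T)}
    (hconj : ∀ (t : ↥T) (x : k),
      Subgroup.inclusion hTG t * u (Multiplicative.ofAdd x) * (Subgroup.inclusion hTG t)⁻¹ =
        u (Multiplicative.ofAdd (((α : ↥T →* kˣ) t : k) * x)))
    (j : ℕ) {χ : ↥(characterLattice T)} {v : n → k} (hv : v ∈ charWeightSpace T χ) :
    (coeffMatrix Pu j).mulVec v ∈ charWeightSpace T (χ * α ^ j) := by
  rw [mem_weightSpace_iff] at hv ⊢
  intro t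
  rw [Matrix.mulVec_mulVec, mul_coeffMatrix hPu hconj t j, Matrix.smul_mulVec,
    ← Matrix.mulVec_mulVec, hv t, Matrix.mulVec_smul, smul_smul]
  congr 1
  simp [mul_comm]

end AddHomCoeff

/-! ### Subspaces stable under a one-parameter group are stable under its coefficients -/

section StableCoeff

open Polynomial

variable [Fintype n] [DecidableEq n]

variable {G : Subgroup (GL n k)} {u : Multiplicative k →* ↥G} {Pu : GLCoord n → k[X]}
  (hPu : ∀ (x : k) (c : GLCoord n),
    glCoordFun ((u (Multiplicative.ofAdd x) : ↥G) : GL n k) c = (Pu c).eval x)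
include hPu

/-- **A subspace stable under an algebraic one-parameter group is stable under its coefficient
matrices**: if `u(x) W ⊆ W` for all `x` (over an infinite field), then `Aⱼ W ⊆ W` for every
coefficient `Aⱼ` of `u(x) = ∑ xʲ Aⱼ` — in particular under the tangent `A₁ = du(1)`. For a linear
form `λ` vanishing on `W` and `w ∈ W`, the polynomial `x ↦ λ(u(x) w) = ∑ xʲ λ(Aⱼ w)` vanishes
identically, so all its coefficients do. [folklore] -/
theorem coeffMatrix_mulVec_mem_of_forall_mem [Infinite k] {W : Submodule k (n → k)}
    (hW : ∀ (x : k), ∀ w ∈ W,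
      (((u (Multiplicative.ofAdd x) : ↥G) : GL n k) : Matrix n n k).mulVec w ∈ W)
    (j : ℕ) {w : n → k} (hw : w ∈ W) : (coeffMatrix Pu j).mulVec w ∈ W := by
  -- it suffices to be killed by every linear form vanishing on `W`
  by_contra hnot
  obtain ⟨f, hf, hfW⟩ := Submodule.exists_dual_map_eq_bot_of_notMem hnot inferInstance
  have hf0 : ∀ v ∈ W, f v = 0 := fun v hv => by
    have h : f v ∈ Submodule.map f W := Submodule.mem_map_of_mem hv
    rwa [hfW, Submodule.mem_bot] at h
  -- the polynomial `∑ xʲ f (Aⱼ w)` vanishes at every `x`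
  let p : k[X] := ∑ i ∈ Finset.range (coeffBound Pu), C (f ((coeffMatrix Pu i).mulVec w)) * X ^ i
  have hp : p = 0 := by
    apply Polynomial.funext
    intro x
    have h := hf0 _ (hW x w hw)
    rw [coe_eq_sum_coeffMatrix hPu x, Matrix.sum_mulVec, map_sum] at h
    simp only [p, Polynomial.eval_finsetSum, Polynomial.eval_mul, Polynomial.eval_C,
      Polynomial.eval_pow, Polynomial.eval_X, Polynomial.eval_zero]
    rw [← h]
    refine Finset.sum_congr rfl fun i _ => ?_
    rw [Matrix.smul_mulVec, map_smul, smul_eq_mul, mul_comm]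
  have hcoeff : p.coeff j = f ((coeffMatrix Pu j).mulVec w) := by
    simp only [p, Polynomial.finsetSum_coeff, Polynomial.coeff_C_mul, Polynomial.coeff_X_pow,
      mul_ite, mul_one, mul_zero]
    rw [Finset.sum_ite_eq]
    by_cases hj : j < coeffBound Pu
    · rw [if_pos (Finset.mem_range.mpr hj)]
    · rw [if_neg (fun h => hj (Finset.mem_range.mp h))]
      -- `j` beyond the bound: `Aⱼ = 0`
      have h0 : coeffMatrix Pu j = 0 := by
        ext a b
        simp only [coeffMatrix, Matrix.of_apply, Matrix.zero_apply]
        apply Polynomial.coeff_eq_zero_of_natDegree_lt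
        have hle := Finset.le_sup (f := fun ab : n × n => (Pu (Sum.inl ab)).natDegree)
          (Finset.mem_univ (a, b))
        unfold coeffBound at hj
        exact lt_of_lt_of_le (Nat.lt_succ_of_le hle) (not_lt.mp hj)
      rw [h0, Matrix.zero_mulVec, map_zero]
  rw [hp, Polynomial.coeff_zero] at hcoeff
  exact hf hcoeff.symm

end StableCoeff

/-! ### Root subgroups of rank-raising roots lie in the level group -/

section RootSubgroups

variable [Fintype n] [DecidableEq n] {G T : Subgroup (GL n k)}

/-- If the character `α` raises the rank — `V_{χ αʲ}` lies in the first filtration step seen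
from the weight `χ`, for `j ≥ 1` — then the image of every root homomorphism with character
`α` lies in the first raising group (hence in the level group) of the weight decomposition:
`u(x) = 1 + ∑_{j ≥ 1} xʲ Aⱼ` with `Aⱼ V_χ ⊆ V_{χ αʲ}`. [folklore] -/
theorem mem_raisingGroup_one_of_isRootHom [Infinite k] {r : Weights T → ℕ}
    {α : ↥(characterLattice T)}
    (hα : ∀ (c : Weights T) (j : ℕ), 1 ≤ j →
      charWeightSpace T (c.1 * α ^ j) ≤
        stepFiltration (fun c : Weights T => charWeightSpace T c.1) r 1 c)
    {hTG : T ≤ G} {u : Multiplicative k →* ↥G} (hu : IsRootHom G T hTG (α : ↥T →* kˣ) u) (x : k) :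
    ((u (Multiplicative.ofAdd x) : ↥G) : GL n k) ∈
      raisingGroup (fun c : Weights T => charWeightSpace T c.1) r 1 := by
  obtain ⟨⟨Pu, hPu⟩, -, hconj⟩ := hu
  have key : ∀ y : k, (((u (Multiplicative.ofAdd y) : ↥G) : GL n k) : Matrix n n k) - 1 ∈
      raising (fun c : Weights T => charWeightSpace T c.1) r 1 := by
    intro y
    rw [coe_sub_one_eq_sum_coeffMatrix hPu y]
    refine Submodule.sum_mem _ fun j _ => Submodule.smul_mem _ _ fun c v hv => ?_
    exact hα c (j + 1) (Nat.le_add_left 1 j) (coeffMatrix_mulVec_mem hPu hconj (j + 1) hv)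
  refine ⟨key x, ?_⟩
  have e : (((u (Multiplicative.ofAdd x) : ↥G) : GL n k)⁻¹ : GL n k) =
      ((u (Multiplicative.ofAdd (-x)) : ↥G) : GL n k) := by
    rw [ofAdd_neg, map_inv, Subgroup.coe_inv]
  rw [e]
  exact key (-x)

/-- Under the same hypothesis the whole root subgroup `U_α` (generated by the images of all root
homomorphisms with character `α`) lies in the level group. [folklore] -/
theorem rootSubgroup_le_levelGroup [Infinite k] {r : Weights T → ℕ} {α : ↥(characterLattice T)}
    (hα : ∀ (c : Weights T) (j : ℕ), 1 ≤ j →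
      charWeightSpace T (c.1 * α ^ j) ≤
        stepFiltration (fun c : Weights T => charWeightSpace T c.1) r 1 c) :
    rootSubgroup G T (α : ↥T →* kˣ) ≤
      levelGroup (fun c : Weights T => charWeightSpace T c.1) r := by
  refine iSup_le fun hTG => iSup_le fun u => iSup_le fun hu => ?_
  rintro _ ⟨g, ⟨m, rfl⟩, rfl⟩
  have h := mem_raisingGroup_one_of_isRootHom hα hu (Multiplicative.toAdd m)
  rw [ofAdd_toAdd] at h
  exact raisingGroup_le_levelGroup le_rfl h

end RootSubgroups

/-! ### The height functional of a base and the positive-step order -/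

section BaseHeight

variable {ι X Y : Type*} [AddCommGroup X] [AddCommGroup Y] (P : RootPairing ι ℤ X Y) (b : P.Base)

/-- The *height functional* on the root lattice `ℤR ⊆ X`: the sum of the coordinates in the
`ℤ`-basis of `ℤR` given by the simple roots of `b` (Mathlib `RootPairing.Base.toWeightBasisInt`);
on a root it is the height `RootPairing.Base.height` (`baseHeightHom_rootSpanMem`).
[folklore] -/
def baseHeightHom : ↥(P.rootSpan ℤ) →ₗ[ℤ] ℤ :=
  ∑ i : ↥b.support, Finsupp.lapply i ∘ₗ b.toWeightBasisInt.repr.toLinearMap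

/-- The height functional is the sum of the coordinates. [folklore] -/
lemma baseHeightHom_apply (q : ↥(P.rootSpan ℤ)) :
    baseHeightHom P b q = ∑ i : ↥b.support, b.toWeightBasisInt.repr q i := by
  simp [baseHeightHom]

/-- The height functional is `1` on simple roots. [folklore] -/
lemma baseHeightHom_toWeightBasisInt (i : ↥b.support) :
    baseHeightHom P b (b.toWeightBasisInt i) = 1 := by
  classical
  rw [baseHeightHom_apply, Module.Basis.repr_self]
  simp [Finsupp.single_apply]

/-- **The height functional of a root is its height.** [folklore] -/
lemma baseHeightHom_rootSpanMem (i : ι) :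
    baseHeightHom P b (P.rootSpanMem ℤ i) = b.height i := by
  obtain ⟨f, -, -, hf⟩ := b.exists_root_eq_sum_int i
  rw [RootPairing.Base.height_eq_sum hf]
  have e : P.rootSpanMem ℤ i = ∑ j : ↥b.support, f j • b.toWeightBasisInt j := by
    apply Subtype.ext
    simp only [Submodule.coe_sum, Submodule.coe_smul_of_tower,
      RootPairing.Base.coe_toWeightBasisInt_apply]
    rw [hf, ← Finset.sum_coe_sort]
  rw [e, map_sum]
  simp only [map_zsmul, baseHeightHom_toWeightBasisInt, smul_eq_mul, mul_one]
  exact Finset.sum_coe_sort b.support f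

/-- The *positive-step* relation on `X`: `x ≺ x'` if `x' - x` lies in the root lattice and has
positive height. A strict partial order. [folklore] -/
def PosStep (x x' : X) : Prop :=
  ∃ h : x' - x ∈ P.rootSpan ℤ, 0 < baseHeightHom P b ⟨x' - x, h⟩

/-- The positive-step relation is irreflexive (`x - x = 0` has height `0`). [folklore] -/
lemma posStep_irrefl (x : X) : ¬ PosStep P b x x := by
  rintro ⟨h, hlt⟩
  have e : (⟨x - x, h⟩ : ↥(P.rootSpan ℤ)) = 0 := Subtype.ext (sub_self x)
  rw [e, map_zero] at hlt
  exact lt_irrefl _ hlt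

variable {P b} in
/-- The positive-step relation is transitive (heights add). [folklore] -/
lemma PosStep.trans {x y z : X} (h₁ : PosStep P b x y) (h₂ : PosStep P b y z) :
    PosStep P b x z := by
  obtain ⟨h1, hlt1⟩ := h₁
  obtain ⟨h2, hlt2⟩ := h₂
  have h3 : z - x ∈ P.rootSpan ℤ := by
    have h := add_mem h1 h2
    rwa [show y - x + (z - y) = z - x by abel] at h
  refine ⟨h3, ?_⟩
  have e : (⟨z - x, h3⟩ : ↥(P.rootSpan ℤ)) = ⟨y - x, h1⟩ + ⟨z - y, h2⟩ :=
    Subtype.ext (by simp only [Submodule.coe_add]; abel)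
  rw [e, map_add]
  exact add_pos hlt1 hlt2

/-- Adding a positive multiple of a positive root is a positive step. [folklore] -/
lemma posStep_add_nsmul_root {i : ι} (hi : b.IsPos i) (x : X) {j : ℕ} (hj : 1 ≤ j) :
    PosStep P b x (x + j • P.root i) := by
  have hmem : x + j • P.root i - x ∈ P.rootSpan ℤ := by
    rw [add_sub_cancel_left]
    exact Submodule.smul_of_tower_mem _ j (P.rootSpanMem ℤ i).2
  refine ⟨hmem, ?_⟩
  have e : (⟨_, hmem⟩ : ↥(P.rootSpan ℤ)) = j • P.rootSpanMem ℤ i :=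
    Subtype.ext (by simp [add_sub_cancel_left])
  rw [e, map_nsmul, baseHeightHom_rootSpanMem]
  exact nsmul_pos hi (by omega)

end BaseHeight

/-! ### Solvability of `T ⊔ ⨆_{α > 0} U_α` -/

section Solvable

variable [Fintype n] [DecidableEq n] {G T : Subgroup (GL n k)}
variable {ι X Y : Type*} [AddCommGroup X] [AddCommGroup Y]

/-- **`⟨T, U_α : α ∈ R⁺(b)⟩` is solvable** (the solvability clause of Springer 8.2.4 (i), for any
commutative `T ≤ G ≤ GL_n` consisting of semisimple elements, over an algebraically closed field,
any root pairing `P` with a base `b` and any identification `eX : X*(T) ≃ X`). Proof by the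
weight filtration: `kⁿ = ⊕ V_χ` (2.4.2 (ii)); rank the weights by the positive-step order of `b`;
`T` is block scalar and every
root homomorphism with `b`-positive character `α` has coefficients `Aⱼ` (`j ≥ 1`) raising the
rank (`Aⱼ V_χ ⊆ V_{χ + jα}`), so the whole group lies in the solvable level group.
[cite: SpringerLAG1998, Prop 8.2.4 (i)] -/
theorem isSolvable_sup_iSup_rootSubgroup_of_isSemisimple [IsAlgClosed k] [IsMulCommutative ↥T]
    (hs : ∀ t ∈ T, IsSemisimpleElt t)
    (P : RootPairing ι ℤ X Y) (b : P.Base) (eX : Additive ↥(characterLattice T) ≃+ X) :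
    IsSolvable ↥(T ⊔ ⨆ (i : ι) (_ : b.IsPos i), rootSubgroup G T (charOfWeight eX (P.root i))) := by
  let W : Weights T → Submodule k (n → k) := fun c => charWeightSpace T c.1
  let e : Weights T → X := fun c => eX (Additive.ofMul c.1)
  let lt : Weights T → Weights T → Prop := fun c c' => PosStep P b (e c) (e c')
  let r : Weights T → ℕ := rankOf lt
  refine isSolvable_of_le_levelGroup (W := W) (r := r) (B := Fintype.card (Weights T) + 1)
    (rankOf_lt lt) (iSup_charWeightSpace_eq_top hs) ?_
  refine sup_le (le_levelGroup_weights r) (iSup₂_le fun i hi => ?_)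
  have hα : ∀ (c : Weights T) (j : ℕ), 1 ≤ j →
      charWeightSpace T (c.1 * (Additive.toMul (eX.symm (P.root i))) ^ j) ≤
        stepFiltration W r 1 c := by
    intro c j hj
    by_cases h0 : charWeightSpace T (c.1 * (Additive.toMul (eX.symm (P.root i))) ^ j) = ⊥
    · rw [h0]
      exact bot_le
    · let c' : Weights T := ⟨c.1 * (Additive.toMul (eX.symm (P.root i))) ^ j, h0⟩
      have hstep : lt c c' := by
        have he : e c' = e c + j • P.root i := by
          simp only [e, c', ofMul_mul, ofMul_pow, ofMul_toMul, map_add, map_nsmul,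
            AddEquiv.apply_symm_apply]
        change PosStep P b (e c) (e c')
        rw [he]
        exact posStep_add_nsmul_root P b hi (e c) hj
      have hr : r c + 1 ≤ r c' :=
        rankOf_lt_rankOf (lt := lt) (fun _ _ _ h₁ h₂ => PosStep.trans h₁ h₂)
          (fun a => posStep_irrefl P b (e a)) hstep
      exact le_stepFiltration (W := W) (r := r) (m := 1) (c := c) (c' := c') hr
  exact rootSubgroup_le_levelGroup (α := Additive.toMul (eX.symm (P.root i))) hα


/-- **`⟨T, U_α : α ∈ R⁺(b)⟩` is solvable for a torus `T`** (the solvability clause of Springer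
8.2.4 (i); `isSolvable_sup_iSup_rootSubgroup_of_isSemisimple` — the connectedness of `T` is not
used). [cite: SpringerLAG1998, Prop 8.2.4 (i)] -/
theorem isSolvable_sup_iSup_rootSubgroup_of_isPos [IsAlgClosed k] (hT : IsTorusSubgroup T)
    (P : RootPairing ι ℤ X Y) (b : P.Base) (eX : Additive ↥(characterLattice T) ≃+ X) :
    IsSolvable ↥(T ⊔ ⨆ (i : ι) (_ : b.IsPos i), rootSubgroup G T (charOfWeight eX (P.root i))) :=
  haveI : IsMulCommutative ↥T := hT.2.1
  isSolvable_sup_iSup_rootSubgroup_of_isSemisimple hT.2.2 P b eX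

end Solvable

end Literature.NumberTheory.Automorphic
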